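import Summits.ValiantsHypothesis.ValiantsHypothesis.Theorems.LacunarySymmetroidMatrixDescartesPivotRankOneCriticalWindowsFourRequiredWeight
import Summits.ValiantsHypothesis.ValiantsHypothesis.Theorems.LacunarySymmetroidMatrixDescartesPivotRankOneCriticalWindowsFourBranchDeriv

/-!
# `MatrixDescartes` census — rank-one `(2,4)₁`: THE FASTEST-LONE-LETTER LAW MODULO THE CUBIC FOLD INEQUALITY
# (at most two critical directions beyond the pivot letter, for every weight vector, GIVEN `𝒞_W > 0` at the fold points)

HONEST FRAMING.  Object-search cell `pub-symmetroid`, seat `val-sym-mdr-p1` (generation 23); helper file `--supports` the crux item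
stmt-ValiantsHypothesis-18050 (`Theses.LacunarySymmetroid.MatrixDescartes`, OPEN, on HOLD) with NO closure claim.  This is a CONDITIONAL count: the
`K = 4` analogue of `…CriticalWindowsThreeLoneLetterCount.lone_letter_three_right` is proved from ONE explicit semialgebraic hypothesis `hC` — the cubic
fold inequality `𝒞_W > 0` of `…FourFoldAlgebra` at every fold point of the given weight family — which is LOCATED (memo MOMENT-FOLD.md: 300/300 pencil
folds, 0 violations in ≈ 10⁶ abstract moment samples) but NOT proved.  So nothing unconditional about the `(2,4)₁` count is claimed; nothing here bears
on `MatrixDescartes` in its window, on `DoorA26`/`DoorA34`, registers / credences, or `VP ≠ VNP`.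

THE STATEMENT (`lone_letter_four_right_of_foldCubic_pos`).  Letters: pivot `0` at `t₀` (rate `−a`), `i, k` at `tᵢ, tₖ < t₀` (rates `bᵢ, bₖ`), the lone
letter `j` at `tⱼ > t₀` with the LARGEST rate `bⱼ > bᵢ, bₖ`; exponents coupled as in the pencil (`dₘ − d₀ ∝ a + bₘ`); ANY positive weights.  If the cubic
form `𝒞_W = 3B₀S₂² − 6B₂S₁S₂ + 2B₃S₁²` is positive at every point `(x, T, Wⱼ)` (`t₀ < T < tⱼ`, `x > 0`, lone weight `Wⱼ > 0`, weights `w₀x^{d₀}, wᵢx^{dᵢ},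
wₖx^{dₖ}, Wⱼ`) at which the two critical equations and the fold relation `A·S₂ = 2S₁²` hold, then there are NO THREE critical points `(x₁,T₁), (x₂,T₂),
(x₃,T₃)` of the four-letter window profile with `t₀ < T₁ < T₂ < T₃`.

THE PROOF (memo §3–§4; all ingredients kernel).  (1) Every critical direction beyond the pivot lies in the strict window `(Tₘ, tⱼ)` (`window_of_critical_four`,
`Three.rightEdge_exists`).  (2) On the window the branch-0 function `φ` of `…FourBranchZero/Deriv` is the unique scale, and the first critical equation
then forces the lone weight: `wⱼ = ω(T) := (∑_{m≠j} wₘφ^{dₘ}Aₘ)/((tⱼ²−T²)φ^{dⱼ})` (`requiredNumerator_pos` makes it positive); three critical directions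
would make `ω` take the value `wⱼ` three times.  (3) `ω` is differentiable; by Rolle there are `c₁ < c₂` in the window with `ω′ = 0`; by
`…FourRequiredWeight.omegaDeriv_eq` (with `…FourFoldAlgebra.foldDenominator_pos`) the index form `𝒥` vanishes at `c₁, c₂`.  (4) `𝒥` along the branch is
continuous, and at each of its zeros `ω′ = 0` and `S₂²·𝒥′ = 2S₁·𝒞_W < 0` (`indexFormDeriv_eq_cubic`, `mixedMoment_neg_of_fastest`, hypothesis `hC`); the
one-zero lemma `eq_of_zeros_of_hasDerivAt_neg` gives `c₁ = c₂`, a contradiction.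
[folklore] Calculus bookkeeping.  No definitions, no named facts (the hypothesis `hC` is an explicit inequality, not a `Prop` definition).
-/

-- `Summit.ValiantsHypothesis.ValiantsHypothesis.…` repeats a component by the D-0017 layout
-- (single-conjunct summit), which the `dupNamespace` linter flags; the name is mandated.
set_option linter.dupNamespace false

open Filter Topology Set

namespace Summit.ValiantsHypothesis.ValiantsHypothesis.Theorems.LacunarySymmetroidMatrixDescartes.Pivot.CriticalWindows.Four

/-! ## 1. Two facts on the branch -/

/-- **THE REQUIRED NUMERATOR IS POSITIVE.**  On the right window, the `j`-free Cramer identity (branch 0) at `(x,T)` forces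
`w₀x^{d₀}A₀ + wᵢx^{dᵢ}Aᵢ + wₖx^{dₖ}Aₖ > 0` (cofactor identities + the signs of the minors). [folklore] -/
theorem requiredNumerator_pos {a bi bk bj t₀ ti tk tj T w₀ wi wk x : ℝ} {d₀ di dk : ℕ} (ha : 0 < a) (hbi : 0 < bi) (hbk : 0 < bk) (hbj : 0 < bj)
    (hti : 0 < ti) (htk : 0 < tk) (hi0 : ti < t₀) (hk0 : tk < t₀) (h0T : t₀ < T) (hTj : T < tj)
    (hwin : bj * (T + t₀) * (tj - T) < a * (T - t₀) * (tj + T)) (hwi : 0 < wi) (hwk : 0 < wk) (hx : 0 < x)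
    (hbr : w₀ * x ^ d₀ * (-((T ^ (2:ℕ) - t₀ ^ (2:ℕ)) * (bj * (T - tj) ^ (2:ℕ)) - (T ^ (2:ℕ) - tj ^ (2:ℕ)) * (-a * (T - t₀) ^ (2:ℕ)))) = wi * x ^ di * (-((T ^ (2:ℕ) - tj ^ (2:ℕ)) * (bi * (T - ti) ^ (2:ℕ)) - (T ^ (2:ℕ) - ti ^ (2:ℕ)) * (bj * (T - tj) ^ (2:ℕ)))) + wk * x ^ dk * (-((T ^ (2:ℕ) - tj ^ (2:ℕ)) * (bk * (T - tk) ^ (2:ℕ)) - (T ^ (2:ℕ) - tk ^ (2:ℕ)) * (bj * (T - tj) ^ (2:ℕ))))) :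
    0 < (w₀ * x ^ d₀ * (T ^ 2 - t₀ ^ 2) + wi * x ^ di * (T ^ 2 - ti ^ 2) + wk * x ^ dk * (T ^ 2 - tk ^ 2)) := by
  obtain ⟨m0j, -, -, mi0, mk0⟩ := minor_signs_right ha hbi hbk hbj hti htk hi0 hk0 h0T hTj hwin
  obtain ⟨ci, ck, -, -⟩ := minor_cofactor_identities (T ^ 2 - t₀ ^ 2) (T ^ 2 - ti ^ 2) (T ^ 2 - tk ^ 2) (T ^ 2 - tj ^ 2)
    (-a * (T - t₀) ^ 2) (bi * (T - ti) ^ 2) (bk * (T - tk) ^ 2) (bj * (T - tj) ^ 2)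
  have key : (w₀ * x ^ d₀ * (T ^ 2 - t₀ ^ 2) + wi * x ^ di * (T ^ 2 - ti ^ 2) + wk * x ^ dk * (T ^ 2 - tk ^ 2)) * ((T ^ (2:ℕ) - t₀ ^ (2:ℕ)) * (bj * (T - tj) ^ (2:ℕ)) - (T ^ (2:ℕ) - tj ^ (2:ℕ)) * (-a * (T - t₀) ^ (2:ℕ)))
      = -(T ^ 2 - tj ^ 2) * (wi * x ^ di * ((T ^ 2 - ti ^ 2) * (-a * (T - t₀) ^ 2) - (T ^ 2 - t₀ ^ 2) * (bi * (T - ti) ^ 2)) + wk * x ^ dk * ((T ^ 2 - tk ^ 2) * (-a * (T - t₀) ^ 2) - (T ^ 2 - t₀ ^ 2) * (bk * (T - tk) ^ 2))) := by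
    linear_combination (-(T ^ 2 - t₀ ^ 2)) * hbr - (wi * x ^ di) * ci - (wk * x ^ dk) * ck
  have hAj : T ^ 2 - tj ^ 2 < 0 := by
    have e : T ^ 2 - tj ^ 2 = (T - tj) * (T + tj) := by ring
    rw [e]; exact mul_neg_of_neg_of_pos (by linarith) (by linarith)
  have hin : wi * x ^ di * ((T ^ 2 - ti ^ 2) * (-a * (T - t₀) ^ 2) - (T ^ 2 - t₀ ^ 2) * (bi * (T - ti) ^ 2)) + wk * x ^ dk * ((T ^ 2 - tk ^ 2) * (-a * (T - t₀) ^ 2) - (T ^ 2 - t₀ ^ 2) * (bk * (T - tk) ^ 2)) < 0 := by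
    have := mul_neg_of_pos_of_neg (mul_pos hwi (pow_pos hx di)) mi0
    have := mul_neg_of_pos_of_neg (mul_pos hwk (pow_pos hx dk)) mk0
    linarith
  have hrhs : -(T ^ 2 - tj ^ 2) * (wi * x ^ di * ((T ^ 2 - ti ^ 2) * (-a * (T - t₀) ^ 2) - (T ^ 2 - t₀ ^ 2) * (bi * (T - ti) ^ 2)) + wk * x ^ dk * ((T ^ 2 - tk ^ 2) * (-a * (T - t₀) ^ 2) - (T ^ 2 - t₀ ^ 2) * (bk * (T - tk) ^ 2))) < 0 :=
    mul_neg_of_pos_of_neg (by linarith) hin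
  rw [← key] at hrhs
  by_contra hcon
  push Not at hcon
  have : 0 ≤ (w₀ * x ^ d₀ * (T ^ 2 - t₀ ^ 2) + wi * x ^ di * (T ^ 2 - ti ^ 2) + wk * x ^ dk * (T ^ 2 - tk ^ 2)) * ((T ^ (2:ℕ) - t₀ ^ (2:ℕ)) * (bj * (T - tj) ^ (2:ℕ)) - (T ^ (2:ℕ) - tj ^ (2:ℕ)) * (-a * (T - t₀) ^ (2:ℕ))) := mul_nonneg_of_nonpos_of_nonpos hcon m0j.le
  linarith

/-- **THE SECOND CRITICAL EQUATION ON THE BRANCH.**  The `j`-free Cramer expression is `Bⱼ·(E1) − Aⱼ·(E2)` identically; so if branch 0 and (E1) hold and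
`Aⱼ ≠ 0` then (E2) holds (here with the lone weight written `O·x^{dⱼ}`). [folklore] -/
theorem critSecond_of_branch {a bi bk bj t₀ ti tk tj T w₀ wi wk x O : ℝ} {d₀ di dk dj : ℕ} (hAj : T ^ 2 - tj ^ 2 ≠ 0)
    (hbr : w₀ * x ^ d₀ * (-((T ^ (2:ℕ) - t₀ ^ (2:ℕ)) * (bj * (T - tj) ^ (2:ℕ)) - (T ^ (2:ℕ) - tj ^ (2:ℕ)) * (-a * (T - t₀) ^ (2:ℕ)))) = wi * x ^ di * (-((T ^ (2:ℕ) - tj ^ (2:ℕ)) * (bi * (T - ti) ^ (2:ℕ)) - (T ^ (2:ℕ) - ti ^ (2:ℕ)) * (bj * (T - tj) ^ (2:ℕ)))) + wk * x ^ dk * (-((T ^ (2:ℕ) - tj ^ (2:ℕ)) * (bk * (T - tk) ^ (2:ℕ)) - (T ^ (2:ℕ) - tk ^ (2:ℕ)) * (bj * (T - tj) ^ (2:ℕ)))))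
    (h1 : (w₀ * x ^ d₀) * (T ^ 2 - t₀ ^ 2) + (wi * x ^ di) * (T ^ 2 - ti ^ 2) + (wk * x ^ dk) * (T ^ 2 - tk ^ 2) + (O * x ^ dj) * (T ^ 2 - tj ^ 2) = 0) :
    (-a) * (w₀ * x ^ d₀) * (T - t₀) ^ 2 + bi * (wi * x ^ di) * (T - ti) ^ 2 + bk * (wk * x ^ dk) * (T - tk) ^ 2 + bj * (O * x ^ dj) * (T - tj) ^ 2 = 0 := by
  have key : (T ^ 2 - tj ^ 2) * ((-a) * (w₀ * x ^ d₀) * (T - t₀) ^ 2 + bi * (wi * x ^ di) * (T - ti) ^ 2 + bk * (wk * x ^ dk) * (T - tk) ^ 2 + bj * (O * x ^ dj) * (T - tj) ^ 2)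
      = (bj * (T - tj) ^ 2) * ((w₀ * x ^ d₀) * (T ^ 2 - t₀ ^ 2) + (wi * x ^ di) * (T ^ 2 - ti ^ 2) + (wk * x ^ dk) * (T ^ 2 - tk ^ 2) + (O * x ^ dj) * (T ^ 2 - tj ^ 2))
        + (w₀ * x ^ d₀ * (-((T ^ (2:ℕ) - t₀ ^ (2:ℕ)) * (bj * (T - tj) ^ (2:ℕ)) - (T ^ (2:ℕ) - tj ^ (2:ℕ)) * (-a * (T - t₀) ^ (2:ℕ)))) - wi * x ^ di * (-((T ^ (2:ℕ) - tj ^ (2:ℕ)) * (bi * (T - ti) ^ (2:ℕ)) - (T ^ (2:ℕ) - ti ^ (2:ℕ)) * (bj * (T - tj) ^ (2:ℕ)))) - wk * x ^ dk * (-((T ^ (2:ℕ) - tj ^ (2:ℕ)) * (bk * (T - tk) ^ (2:ℕ)) - (T ^ (2:ℕ) - tk ^ (2:ℕ)) * (bj * (T - tj) ^ (2:ℕ))))) := by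
    ring
  rw [h1, mul_zero, zero_add] at key
  have hz : w₀ * x ^ d₀ * (-((T ^ (2:ℕ) - t₀ ^ (2:ℕ)) * (bj * (T - tj) ^ (2:ℕ)) - (T ^ (2:ℕ) - tj ^ (2:ℕ)) * (-a * (T - t₀) ^ (2:ℕ)))) - wi * x ^ di * (-((T ^ (2:ℕ) - tj ^ (2:ℕ)) * (bi * (T - ti) ^ (2:ℕ)) - (T ^ (2:ℕ) - ti ^ (2:ℕ)) * (bj * (T - tj) ^ (2:ℕ)))) - wk * x ^ dk * (-((T ^ (2:ℕ) - tj ^ (2:ℕ)) * (bk * (T - tk) ^ (2:ℕ)) - (T ^ (2:ℕ) - tk ^ (2:ℕ)) * (bj * (T - tj) ^ (2:ℕ)))) = 0 := by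
    linear_combination hbr
  rw [hz] at key
  rcases mul_eq_zero.mp key with h | h
  · exact absurd h hAj
  · exact h


/-! ## 2. The conditional lone-letter law -/

set_option maxHeartbeats 2000000 in
-- one long assembly (three windows, the branch, Rolle twice, the one-zero lemma) over large spelled terms
/-- **THE FASTEST-LONE-LETTER LAW MODULO THE CUBIC FOLD INEQUALITY (`K = 4`, right side).**  See the module docstring.  Hypothesis `hC` is the located,
unproved inequality `𝒞_W > 0` at fold points of the weight family; everything else is unconditional. [folklore] -/
theorem lone_letter_four_right_of_foldCubic_pos {a bi bk bj t₀ ti tk tj w₀ wi wk wj : ℝ} {d₀ di dk dj : ℕ}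
    (ha : 0 < a) (hbi : 0 < bi) (hbk : 0 < bk) (hbj : 0 < bj) (hij : bi < bj) (hkj : bk < bj)
    (hti : 0 < ti) (htk : 0 < tk) (hi0 : ti < t₀) (hk0 : tk < t₀) (h0j : t₀ < tj)
    (hw₀ : 0 < w₀) (hwi : 0 < wi) (hwk : 0 < wk) (hwj : 0 < wj) (h0i : d₀ < di) (h0k : d₀ < dk)
    (hci : (a + bi) * ((dk : ℝ) - d₀) = (a + bk) * ((di : ℝ) - d₀)) (hcj : (a + bi) * ((dj : ℝ) - d₀) = (a + bj) * ((di : ℝ) - d₀))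
    (hC : ∀ T x O : ℝ, t₀ < T → T < tj → 0 < x → 0 < O →
        (w₀ * x ^ d₀) * (T ^ 2 - t₀ ^ 2) + (wi * x ^ di) * (T ^ 2 - ti ^ 2) + (wk * x ^ dk) * (T ^ 2 - tk ^ 2) + (O * x ^ dj) * (T ^ 2 - tj ^ 2) = 0 →
        (-a) * (w₀ * x ^ d₀) * (T - t₀) ^ 2 + bi * (wi * x ^ di) * (T - ti) ^ 2 + bk * (wk * x ^ dk) * (T - tk) ^ 2 + bj * (O * x ^ dj) * (T - tj) ^ 2 = 0 →
        ((w₀ * x ^ d₀) + (wi * x ^ di) + (wk * x ^ dk) + (O * x ^ dj)) * ((-a) ^ 2 * (w₀ * x ^ d₀) * (T - t₀) ^ 2 + bi ^ 2 * (wi * x ^ di) * (T - ti) ^ 2 + bk ^ 2 * (wk * x ^ dk) * (T - tk) ^ 2 + bj ^ 2 * (O * x ^ dj) * (T - tj) ^ 2) = 2 * ((-a) * (w₀ * x ^ d₀) * (T - t₀) + bi * (wi * x ^ di) * (T - ti) + bk * (wk * x ^ dk) * (T - tk) + bj * (O * x ^ dj) * (T - tj)) ^ 2 →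
        0 < (3 * ((-a) * (w₀ * x ^ d₀) + bi * (wi * x ^ di) + bk * (wk * x ^ dk) + bj * (O * x ^ dj)) * ((-a) ^ 2 * (w₀ * x ^ d₀) * (T - t₀) ^ 2 + bi ^ 2 * (wi * x ^ di) * (T - ti) ^ 2 + bk ^ 2 * (wk * x ^ dk) * (T - tk) ^ 2 + bj ^ 2 * (O * x ^ dj) * (T - tj) ^ 2) ^ 2 - 6 * ((-a) ^ 2 * (w₀ * x ^ d₀) * (T - t₀) + bi ^ 2 * (wi * x ^ di) * (T - ti) + bk ^ 2 * (wk * x ^ dk) * (T - tk) + bj ^ 2 * (O * x ^ dj) * (T - tj)) * ((-a) * (w₀ * x ^ d₀) * (T - t₀) + bi * (wi * x ^ di) * (T - ti) + bk * (wk * x ^ dk) * (T - tk) + bj * (O * x ^ dj) * (T - tj)) * ((-a) ^ 2 * (w₀ * x ^ d₀) * (T - t₀) ^ 2 + bi ^ 2 * (wi * x ^ di) * (T - ti) ^ 2 + bk ^ 2 * (wk * x ^ dk) * (T - tk) ^ 2 + bj ^ 2 * (O * x ^ dj) * (T - tj) ^ 2) + 2 * ((-a) ^ 3 * (w₀ *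 x ^ d₀) * (T - t₀) ^ 2 + bi ^ 3 * (wi * x ^ di) * (T - ti) ^ 2 + bk ^ 3 * (wk * x ^ dk) * (T - tk) ^ 2 + bj ^ 3 * (O * x ^ dj) * (T - tj) ^ 2) * ((-a) * (w₀ * x ^ d₀) * (T - t₀) + bi * (wi * x ^ di) * (T - ti) + bk * (wk * x ^ dk) * (T - tk) + bj * (O * x ^ dj) * (T - tj)) ^ 2))
    {x₁ x₂ x₃ T₁ T₂ T₃ : ℝ} (hx₁ : 0 < x₁) (hx₂ : 0 < x₂) (hx₃ : 0 < x₃)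
    (h01 : t₀ < T₁) (h12 : T₁ < T₂) (h23 : T₂ < T₃)
    (c₁ : w₀ * x₁ ^ d₀ * (T₁ ^ 2 - t₀ ^ 2) + wi * x₁ ^ di * (T₁ ^ 2 - ti ^ 2) + wk * x₁ ^ dk * (T₁ ^ 2 - tk ^ 2) + wj * x₁ ^ dj * (T₁ ^ 2 - tj ^ 2) = 0)
    (c₁' : w₀ * x₁ ^ d₀ * (-a * (T₁ - t₀) ^ 2) + wi * x₁ ^ di * (bi * (T₁ - ti) ^ 2) + wk * x₁ ^ dk * (bk * (T₁ - tk) ^ 2) + wj * x₁ ^ dj * (bj * (T₁ - tj) ^ 2) = 0)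
    (c₂ : w₀ * x₂ ^ d₀ * (T₂ ^ 2 - t₀ ^ 2) + wi * x₂ ^ di * (T₂ ^ 2 - ti ^ 2) + wk * x₂ ^ dk * (T₂ ^ 2 - tk ^ 2) + wj * x₂ ^ dj * (T₂ ^ 2 - tj ^ 2) = 0)
    (c₂' : w₀ * x₂ ^ d₀ * (-a * (T₂ - t₀) ^ 2) + wi * x₂ ^ di * (bi * (T₂ - ti) ^ 2) + wk * x₂ ^ dk * (bk * (T₂ - tk) ^ 2) + wj * x₂ ^ dj * (bj * (T₂ - tj) ^ 2) = 0)
    (c₃ : w₀ * x₃ ^ d₀ * (T₃ ^ 2 - t₀ ^ 2) + wi * x₃ ^ di * (T₃ ^ 2 - ti ^ 2) + wk * x₃ ^ dk * (T₃ ^ 2 - tk ^ 2) + wj * x₃ ^ dj * (T₃ ^ 2 - tj ^ 2) = 0)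
    (c₃' : w₀ * x₃ ^ d₀ * (-a * (T₃ - t₀) ^ 2) + wi * x₃ ^ di * (bi * (T₃ - ti) ^ 2) + wk * x₃ ^ dk * (bk * (T₃ - tk) ^ 2) + wj * x₃ ^ dj * (bj * (T₃ - tj) ^ 2) = 0) :
    False := by
  have ht₀ : 0 < t₀ := lt_trans hti hi0
  have htj : 0 < tj := lt_trans ht₀ h0j
  -- (0) the coupling constants
  obtain ⟨lam, hlam, c, hd₀, hdi, hdk, hdj⟩ : ∃ lam : ℝ, 0 < lam ∧ ∃ c : ℝ, (d₀ : ℝ) = c + lam * (-a) ∧ (di : ℝ) = c + lam * bi ∧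
      (dk : ℝ) = c + lam * bk ∧ (dj : ℝ) = c + lam * bj := by
    have hab : 0 < a + bi := by linarith
    have hdd : (d₀ : ℝ) < di := by exact_mod_cast h0i
    refine ⟨((di : ℝ) - d₀) / (a + bi), div_pos (by linarith) hab, (d₀ : ℝ) + ((di : ℝ) - d₀) / (a + bi) * a, by ring, ?_, ?_, ?_⟩
    · field_simp; ring
    · field_simp; linear_combination hci
    · field_simp; linear_combination hcj
  -- (1) the strict windows and the left edge `Tm`
  have win : ∀ x T : ℝ, 0 < x → t₀ < T → w₀ * x ^ d₀ * (T ^ 2 - t₀ ^ 2) + wi * x ^ di * (T ^ 2 - ti ^ 2) + wk * x ^ dk * (T ^ 2 - tk ^ 2) + wj * x ^ dj * (T ^ 2 - tj ^ 2) = 0 → w₀ * x ^ d₀ * (-a * (T - t₀) ^ 2) + wi * x ^ di * (bi * (T - ti) ^ 2) + wk * x ^ dk * (bk * (T - tk) ^ 2) + wj * x ^ dj * (bj * (T - tj) ^ 2) = 0 →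
      T < tj ∧ bj * (T + t₀) * (tj - T) < a * (T - t₀) * (tj + T) := by
    intro x T hx hT e1 e2
    exact window_of_critical_four (W₀ := w₀ * x ^ d₀) (Wi := wi * x ^ di) (Wk := wk * x ^ dk) (Wj := wj * x ^ dj) ha hbi hbk hbj
      (mul_pos hwi (pow_pos hx di)) (mul_pos hwk (pow_pos hx dk)) (mul_pos hwj (pow_pos hx dj)) hti htk htj hi0 hk0 hT
      (by linear_combination e1) (by linear_combination e2)
  obtain ⟨Tm, hTm0, hTmj, hroot, hpos, hQi, -⟩ := Three.rightEdge_exists ha hbj ht₀ h0j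
  have above : ∀ T : ℝ, t₀ < T → bj * (T + t₀) * (tj - T) < a * (T - t₀) * (tj + T) → Tm < T := by
    intro T hT hw
    by_contra hcon
    push Not at hcon
    have e : a * (T + tj) * (T - t₀) = a * (T - t₀) * (tj + T) := by ring
    rcases eq_or_lt_of_le hcon with heq | hlt
    · rw [heq] at hw; rw [heq] at e; linarith
    · have := hpos T (by linarith) hlt
      linarith
  have hwinT : ∀ T : ℝ, Tm < T → bj * (T + t₀) * (tj - T) < a * (T - t₀) * (tj + T) := by
    intro T hT
    have := hQi T hT
    have e : a * (T + tj) * (T - t₀) = a * (T - t₀) * (tj + T) := by ring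
    linarith
  -- (2) the branch-0 function
  obtain ⟨φ, hφ, huniq, -, -, hder⟩ := branch0_hasDerivAt ha hbi hbk hbj hti htk hi0 hk0 h0j hTm0.le hQi hw₀ hwi hwk h0i h0k
  -- (3) the required weight
  obtain ⟨ω, hωdef⟩ : ∃ ω : ℝ → ℝ, ∀ T : ℝ, ω T = (w₀ * φ T ^ d₀ * (T ^ 2 - t₀ ^ 2) + wi * φ T ^ di * (T ^ 2 - ti ^ 2) + wk * φ T ^ dk * (T ^ 2 - tk ^ 2)) / ((tj ^ 2 - T ^ 2) * φ T ^ dj) :=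
    ⟨fun T => (w₀ * φ T ^ d₀ * (T ^ 2 - t₀ ^ 2) + wi * φ T ^ di * (T ^ 2 - ti ^ 2) + wk * φ T ^ dk * (T ^ 2 - tk ^ 2)) / ((tj ^ 2 - T ^ 2) * φ T ^ dj), fun T => rfl⟩
  have hN : ∀ T : ℝ, Tm < T → T < tj → 0 < (w₀ * φ T ^ d₀ * (T ^ 2 - t₀ ^ 2) + wi * φ T ^ di * (T ^ 2 - ti ^ 2) + wk * φ T ^ dk * (T ^ 2 - tk ^ 2)) := by
    intro T h1 h2
    obtain ⟨hφpos, hbr⟩ := hφ T h1 h2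
    exact requiredNumerator_pos ha hbi hbk hbj hti htk hi0 hk0 (by linarith) h2 (hwinT T h1) hwi hwk hφpos hbr
  have hD : ∀ T : ℝ, Tm < T → T < tj → 0 < ((tj ^ 2 - T ^ 2) * φ T ^ dj) := by
    intro T h1 h2
    obtain ⟨hφpos, -⟩ := hφ T h1 h2
    have e : tj ^ 2 - T ^ 2 = (tj - T) * (tj + T) := by ring
    have : 0 < tj ^ 2 - T ^ 2 := by rw [e]; exact mul_pos (by linarith) (by linarith)
    exact mul_pos this (pow_pos hφpos dj)
  have hωpos : ∀ T : ℝ, Tm < T → T < tj → 0 < ω T := by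
    intro T h1 h2; rw [hωdef]; exact div_pos (hN T h1 h2) (hD T h1 h2)
  have hE1 : ∀ T : ℝ, Tm < T → T < tj → (w₀ * φ T ^ d₀) * (T ^ 2 - t₀ ^ 2) + (wi * φ T ^ di) * (T ^ 2 - ti ^ 2) + (wk * φ T ^ dk) * (T ^ 2 - tk ^ 2) + (ω T * φ T ^ dj) * (T ^ 2 - tj ^ 2) = 0 := by
    intro T h1 h2
    have hDne : ((tj ^ 2 - T ^ 2) * φ T ^ dj) ≠ 0 := ne_of_gt (hD T h1 h2)
    have hφne : φ T ^ dj ≠ 0 := pow_ne_zero _ (ne_of_gt (hφ T h1 h2).1)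
    have hAne : tj ^ 2 - T ^ 2 ≠ 0 := by
      have e : tj ^ 2 - T ^ 2 = (tj - T) * (tj + T) := by ring
      rw [e]; exact mul_ne_zero (by linarith) (by linarith)
    rw [hωdef]
    field_simp
    ring
  have hE2 : ∀ T : ℝ, Tm < T → T < tj → (-a) * (w₀ * φ T ^ d₀) * (T - t₀) ^ 2 + bi * (wi * φ T ^ di) * (T - ti) ^ 2 + bk * (wk * φ T ^ dk) * (T - tk) ^ 2 + bj * (ω T * φ T ^ dj) * (T - tj) ^ 2 = 0 := by
    intro T h1 h2
    have hAj : T ^ 2 - tj ^ 2 ≠ 0 := by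
      have e : T ^ 2 - tj ^ 2 = (T - tj) * (T + tj) := by ring
      rw [e]; exact mul_ne_zero (by linarith) (by linarith)
    exact critSecond_of_branch hAj (hφ T h1 h2).2 (hE1 T h1 h2)
  -- (4) every critical point beyond the pivot lies on the branch and requires the weight `ω`
  have onb : ∀ x T : ℝ, 0 < x → t₀ < T → w₀ * x ^ d₀ * (T ^ 2 - t₀ ^ 2) + wi * x ^ di * (T ^ 2 - ti ^ 2) + wk * x ^ dk * (T ^ 2 - tk ^ 2) + wj * x ^ dj * (T ^ 2 - tj ^ 2) = 0 → w₀ * x ^ d₀ * (-a * (T - t₀) ^ 2) + wi * x ^ di * (bi * (T - ti) ^ 2) + wk * x ^ dk * (bk * (T - tk) ^ 2) + wj * x ^ dj * (bj * (T - tj) ^ 2) = 0 →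
      Tm < T ∧ T < tj ∧ ω T = wj := by
    intro x T hx hT e1 e2
    obtain ⟨hTj, hw⟩ := win x T hx hT e1 e2
    have hTm : Tm < T := above T hT hw
    obtain ⟨cx, -⟩ := weights_cramer_four (T ^ 2 - t₀ ^ 2) (T ^ 2 - ti ^ 2) (T ^ 2 - tk ^ 2) (T ^ 2 - tj ^ 2)
      (-a * (T - t₀) ^ 2) (bi * (T - ti) ^ 2) (bk * (T - tk) ^ 2) (bj * (T - tj) ^ 2)
      (w₀ * x ^ d₀) (wi * x ^ di) (wk * x ^ dk) (wj * x ^ dj) (by linear_combination e1) (by linear_combination e2)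
    have hbr : w₀ * x ^ d₀ * (-((T ^ (2:ℕ) - t₀ ^ (2:ℕ)) * (bj * (T - tj) ^ (2:ℕ)) - (T ^ (2:ℕ) - tj ^ (2:ℕ)) * (-a * (T - t₀) ^ (2:ℕ)))) = wi * x ^ di * (-((T ^ (2:ℕ) - tj ^ (2:ℕ)) * (bi * (T - ti) ^ (2:ℕ)) - (T ^ (2:ℕ) - ti ^ (2:ℕ)) * (bj * (T - tj) ^ (2:ℕ)))) + wk * x ^ dk * (-((T ^ (2:ℕ) - tj ^ (2:ℕ)) * (bk * (T - tk) ^ (2:ℕ)) - (T ^ (2:ℕ) - tk ^ (2:ℕ)) * (bj * (T - tj) ^ (2:ℕ)))) := by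
      linear_combination (-1 : ℝ) * cx
    have hxφ : x = φ T := huniq T x hTm hTj hx hbr
    refine ⟨hTm, hTj, ?_⟩
    rw [hωdef, ← hxφ]
    have hDne : (tj ^ 2 - T ^ 2) * x ^ dj ≠ 0 := by
      have e : tj ^ 2 - T ^ 2 = (tj - T) * (tj + T) := by ring
      have : 0 < tj ^ 2 - T ^ 2 := by rw [e]; exact mul_pos (by linarith) (by linarith)
      exact mul_ne_zero (ne_of_gt this) (pow_ne_zero _ (ne_of_gt hx))
    rw [div_eq_iff hDne]
    linear_combination e1
  obtain ⟨hTm1, hT1j, hω1⟩ := onb x₁ T₁ hx₁ h01 c₁ c₁'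
  obtain ⟨hTm2, hT2j, hω2⟩ := onb x₂ T₂ hx₂ (by linarith) c₂ c₂'
  obtain ⟨hTm3, hT3j, hω3⟩ := onb x₃ T₃ hx₃ (by linarith) c₃ c₃'
  -- (5) differentiability of `ω`
  have hωfun : ω = fun T' => (w₀ * φ T' ^ d₀ * (T' ^ 2 - t₀ ^ 2) + wi * φ T' ^ di * (T' ^ 2 - ti ^ 2) + wk * φ T' ^ dk * (T' ^ 2 - tk ^ 2)) / ((tj ^ 2 - T' ^ 2) * φ T' ^ dj) := funext hωdef
  have hdiffω : ∀ T : ℝ, Tm < T → T < tj → DifferentiableAt ℝ ω T := by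
    intro T h1 h2
    obtain ⟨-, hφd⟩ := hder T h1 h2
    obtain ⟨a0, -⟩ := hasDerivAt_sq_sub t₀ T
    obtain ⟨ai, -⟩ := hasDerivAt_sq_sub ti T
    obtain ⟨ak, -⟩ := hasDerivAt_sq_sub tk T
    have n0 := ((hφd.fun_pow d₀).const_mul w₀).fun_mul a0
    have ni := ((hφd.fun_pow di).const_mul wi).fun_mul ai
    have nk := ((hφd.fun_pow dk).const_mul wk).fun_mul ak
    have hNd := (n0.fun_add ni).fun_add nk
    have hAj : HasDerivAt (fun T' : ℝ => tj ^ 2 - T' ^ 2) (-(2 * T)) T := by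
      simpa using (hasDerivAt_pow 2 T).const_sub (tj ^ 2)
    have hDd := hAj.fun_mul (hφd.fun_pow dj)
    rw [hωfun]
    exact (hNd.fun_div hDd (ne_of_gt (hD T h1 h2))).differentiableAt
  -- (6) Rolle twice
  have rolle : ∀ P Q : ℝ, Tm < P → P < Q → Q < tj → ω P = ω Q → ∃ cc ∈ Ioo P Q, deriv ω cc = 0 := by
    intro P Q hP hPQ hQ hPQe
    have hcont : ContinuousOn ω (Icc P Q) := fun T hT =>
      ((hdiffω T (by linarith [hT.1]) (by linarith [hT.2])).continuousAt).continuousWithinAt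
    exact exists_hasDerivAt_eq_zero hPQ hcont hPQe (fun T hT => (hdiffω T (by linarith [hT.1]) (by linarith [hT.2])).hasDerivAt)
  obtain ⟨k₁, hk₁, hk₁0⟩ := rolle T₁ T₂ hTm1 h12 hT2j (by rw [hω1, hω2])
  obtain ⟨k₂, hk₂, hk₂0⟩ := rolle T₂ T₃ hTm2 h23 hT3j (by rw [hω2, hω3])
  -- (7) the index form along the branch and its zeros
  obtain ⟨J, hJdef⟩ : ∃ J : ℝ → ℝ, ∀ T' : ℝ, J T' = 2 * ((-a) * (w₀ * φ T' ^ d₀) * (T' - t₀) + bi * (wi * φ T' ^ di) * (T' - ti) + bk * (wk * φ T' ^ dk) * (T' - tk) + bj * (ω T' * φ T' ^ dj) * (T' - tj)) ^ 2 - (w₀ * φ T' ^ d₀ + wi * φ T' ^ di + wk * φ T' ^ dk + ω T' * φ T' ^ dj) * ((-a) ^ 2 * (w₀ * φ T' ^ d₀) * (T' - t₀) ^ 2 + bi ^ 2 * (wi * φ T' ^ di) * (T' - ti) ^ 2 + bk ^ 2 * (wk * φ T' ^ dk) * (T' - tk) ^ 2 + bj ^ 2 * (ω T' * φ T' ^ dj)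 * (T' - tj) ^ 2) := ⟨fun T' => 2 * ((-a) * (w₀ * φ T' ^ d₀) * (T' - t₀) + bi * (wi * φ T' ^ di) * (T' - ti) + bk * (wk * φ T' ^ dk) * (T' - tk) + bj * (ω T' * φ T' ^ dj) * (T' - tj)) ^ 2 - (w₀ * φ T' ^ d₀ + wi * φ T' ^ di + wk * φ T' ^ dk + ω T' * φ T' ^ dj) * ((-a) ^ 2 * (w₀ * φ T' ^ d₀) * (T' - t₀) ^ 2 + bi ^ 2 * (wi * φ T' ^ di) * (T' - ti) ^ 2 + bk ^ 2 * (wk * φ T' ^ dk) * (T' - tk) ^ 2 + bj ^ 2 * (ω T' * φ T' ^ dj) * (T' - tj) ^ 2), fun T' => rfl⟩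
  have hJfun : J = fun T' => 2 * ((-a) * (w₀ * φ T' ^ d₀) * (T' - t₀) + bi * (wi * φ T' ^ di) * (T' - ti) + bk * (wk * φ T' ^ dk) * (T' - tk) + bj * (ω T' * φ T' ^ dj) * (T' - tj)) ^ 2 - (w₀ * φ T' ^ d₀ + wi * φ T' ^ di + wk * φ T' ^ dk + ω T' * φ T' ^ dj) * ((-a) ^ 2 * (w₀ * φ T' ^ d₀) * (T' - t₀) ^ 2 + bi ^ 2 * (wi * φ T' ^ di) * (T' - ti) ^ 2 + bk ^ 2 * (wk * φ T' ^ dk) * (T' - tk) ^ 2 + bj ^ 2 * (ω T' * φ T' ^ dj) * (T' - tj) ^ 2) := funext hJdef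
  -- raw derivatives of the two critical expressions vanish along the branch
  have hraw : ∀ T : ℝ, Tm < T → T < tj → ∀ XP OP : ℝ, HasDerivAt φ XP T → HasDerivAt ω OP T →
      ((w₀ * ((d₀:ℝ) * (φ T) ^ (d₀ - 1) * (XP))) * (T ^ 2 - t₀ ^ 2) + (w₀ * (φ T) ^ d₀) * (2 * T)) + ((wi * ((di:ℝ) * (φ T) ^ (di - 1) * (XP))) * (T ^ 2 - ti ^ 2) + (wi * (φ T) ^ di) * (2 * T)) + ((wk * ((dk:ℝ) * (φ T) ^ (dk - 1) * (XP))) * (T ^ 2 - tk ^ 2) + (wk * (φ T) ^ dk) * (2 * T)) + (((OP) * (φ T) ^ dj + (ω T) * ((dj:ℝ) * (φ T) ^ (dj - 1) * (XP))) * (T ^ 2 - tj ^ 2) + ((ω T) * (φ T) ^ dj) * (2 * T)) = 0 ∧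
      ((-a) * (w₀ * ((d₀:ℝ) * (φ T) ^ (d₀ - 1) * (XP))) * (T - t₀) ^ 2 + (-a) * (w₀ * (φ T) ^ d₀) * (2 * (T - t₀))) + (bi * (wi * ((di:ℝ) * (φ T) ^ (di - 1) * (XP))) * (T - ti) ^ 2 + bi * (wi * (φ T) ^ di) * (2 * (T - ti))) + (bk * (wk * ((dk:ℝ) * (φ T) ^ (dk - 1) * (XP))) * (T - tk) ^ 2 + bk * (wk * (φ T) ^ dk) * (2 * (T - tk))) + (bj * ((OP) * (φ T) ^ dj + (ω T) * ((dj:ℝ) * (φ T) ^ (dj - 1) * (XP))) * (T - tj) ^ 2 + bj * ((ω T) * (φ T) ^ dj) * (2 * (T - tj))) = 0 := by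
    intro T h1 h2 XP OP hφd hωd
    have hd1 := hasDerivAt_critFirst w₀ wi wk t₀ ti tk tj T d₀ di dk dj rfl rfl hφd hωd
    have hd2 := hasDerivAt_critSecond w₀ wi wk a bi bk bj t₀ ti tk tj T d₀ di dk dj rfl rfl hφd hωd
    have hev1 : (fun T' : ℝ => w₀ * φ T' ^ d₀ * (T' ^ 2 - t₀ ^ 2) + wi * φ T' ^ di * (T' ^ 2 - ti ^ 2) + wk * φ T' ^ dk * (T' ^ 2 - tk ^ 2) + ω T' * φ T' ^ dj * (T' ^ 2 - tj ^ 2)) =ᶠ[𝓝 T] fun _ => (0 : ℝ) := by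
      filter_upwards [Ioo_mem_nhds h1 h2] with T' hT'
      exact hE1 T' hT'.1 hT'.2
    have hev2 : (fun T' : ℝ => (-a) * (w₀ * φ T' ^ d₀) * (T' - t₀) ^ 2 + bi * (wi * φ T' ^ di) * (T' - ti) ^ 2 + bk * (wk * φ T' ^ dk) * (T' - tk) ^ 2 + bj * (ω T' * φ T' ^ dj) * (T' - tj) ^ 2) =ᶠ[𝓝 T] fun _ => (0 : ℝ) := by
      filter_upwards [Ioo_mem_nhds h1 h2] with T' hT'
      exact hE2 T' hT'.1 hT'.2
    have z1 : HasDerivAt (fun T' : ℝ => w₀ * φ T' ^ d₀ * (T' ^ 2 - t₀ ^ 2) + wi * φ T' ^ di * (T' ^ 2 - ti ^ 2) + wk * φ T' ^ dk * (T' ^ 2 - tk ^ 2) + ω T' * φ T' ^ dj * (T' ^ 2 - tj ^ 2)) 0 T := (hasDerivAt_const T (0 : ℝ)).congr_of_eventuallyEq hev1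
    have z2 : HasDerivAt (fun T' : ℝ => (-a) * (w₀ * φ T' ^ d₀) * (T' - t₀) ^ 2 + bi * (wi * φ T' ^ di) * (T' - ti) ^ 2 + bk * (wk * φ T' ^ dk) * (T' - tk) ^ 2 + bj * (ω T' * φ T' ^ dj) * (T' - tj) ^ 2) 0 T := (hasDerivAt_const T (0 : ℝ)).congr_of_eventuallyEq hev2
    exact ⟨hd1.unique z1, hd2.unique z2⟩
  -- positivity of the weights on the branch
  have hWpos : ∀ T : ℝ, Tm < T → T < tj → 0 < w₀ * φ T ^ d₀ ∧ 0 < wi * φ T ^ di ∧ 0 < wk * φ T ^ dk ∧ 0 < ω T * φ T ^ dj := by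
    intro T h1 h2
    have hp := (hφ T h1 h2).1
    exact ⟨mul_pos hw₀ (pow_pos hp _), mul_pos hwi (pow_pos hp _), mul_pos hwk (pow_pos hp _), mul_pos (hωpos T h1 h2) (pow_pos hp _)⟩
  -- at a zero of `deriv ω`, `J` vanishes; at a zero of `J`, `deriv ω` vanishes
  have hJω : ∀ T : ℝ, Tm < T → T < tj → (deriv ω T = 0 ↔ J T = 0) := by
    intro T h1 h2
    obtain ⟨-, hφd⟩ := hder T h1 h2
    have hωd := (hdiffω T h1 h2).hasDerivAt
    obtain ⟨r1, r2⟩ := hraw T h1 h2 _ _ hφd hωd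
    have hX : φ T ≠ 0 := ne_of_gt (hφ T h1 h2).1
    have hO : ω T ≠ 0 := ne_of_gt (hωpos T h1 h2)
    have key := omegaDeriv_eq hX hO hd₀ hdi hdk hdj (hE1 T h1 h2) (hE2 T h1 h2) r1 r2
    obtain ⟨p0, pi, pk, pj⟩ := hWpos T h1 h2
    have hDpos := foldDenominator_pos (W₀ := w₀ * φ T ^ d₀) (Wi := wi * φ T ^ di) (Wk := wk * φ T ^ dk) (Wj := ω T * φ T ^ dj)
      p0 pi pk ha hbi hbk hbj hti htk hi0 hk0 (by linarith) h2 (hwinT T h1)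
    have hT : 0 < T := by linarith
    rw [hJdef]
    constructor
    · intro h0
      rw [h0, zero_mul] at key
      have : (2 * T * lam * ω T) * (2 * ((-a) * (w₀ * φ T ^ d₀) * (T - t₀) + bi * (wi * φ T ^ di) * (T - ti) + bk * (wk * φ T ^ dk) * (T - tk) + bj * (ω T * φ T ^ dj) * (T - tj)) ^ 2 - ((w₀ * φ T ^ d₀) + (wi * φ T ^ di) + (wk * φ T ^ dk) + (ω T * φ T ^ dj)) * ((-a) ^ 2 * (w₀ * φ T ^ d₀) * (T - t₀) ^ 2 + bi ^ 2 * (wi * φ T ^ di) * (T - ti) ^ 2 + bk ^ 2 * (wk * φ T ^ dk) * (T - tk) ^ 2 + bj ^ 2 * (ω T * φ T ^ dj) * (T - tj) ^ 2)) = 0 := by linear_combination key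
      rcases mul_eq_zero.mp this with h | h
      · exfalso
        have : 0 < 2 * T * lam * ω T := mul_pos (mul_pos (mul_pos two_pos hT) hlam) (hωpos T h1 h2)
        linarith
      · exact h
    · intro hJ0
      rw [hJ0] at key
      have : deriv ω T * (lam * (ω T * φ T ^ dj) * (bj * (T - tj) ^ 2 * ((-a) * (w₀ * φ T ^ d₀) * (T ^ 2 - t₀ ^ 2) + bi * (wi * φ T ^ di) * (T ^ 2 - ti ^ 2) + bk * (wk * φ T ^ dk) * (T ^ 2 - tk ^ 2) + bj * (ω T * φ T ^ dj) * (T ^ 2 - tj ^ 2)) + (tj ^ 2 - T ^ 2) * ((-a) ^ 2 * (w₀ * φ T ^ d₀) * (T - t₀) ^ 2 + bi ^ 2 * (wi * φ T ^ di) * (T - ti) ^ 2 + bk ^ 2 * (wk * φ T ^ dk) * (T - tk) ^ 2 + bj ^ 2 * (ω T * φ T ^ dj) * (T - tj) ^ 2))) = 0 := by rw [key]; ring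
      rcases mul_eq_zero.mp this with h | h
      · exact h
      · exfalso
        have : 0 < lam * (ω T * φ T ^ dj) * (bj * (T - tj) ^ 2 * ((-a) * (w₀ * φ T ^ d₀) * (T ^ 2 - t₀ ^ 2) + bi * (wi * φ T ^ di) * (T ^ 2 - ti ^ 2) + bk * (wk * φ T ^ dk) * (T ^ 2 - tk ^ 2) + bj * (ω T * φ T ^ dj) * (T ^ 2 - tj ^ 2)) + (tj ^ 2 - T ^ 2) * ((-a) ^ 2 * (w₀ * φ T ^ d₀) * (T - t₀) ^ 2 + bi ^ 2 * (wi * φ T ^ di) * (T - ti) ^ 2 + bk ^ 2 * (wk * φ T ^ dk) * (T - tk) ^ 2 + bj ^ 2 * (ω T * φ T ^ dj) * (T - tj) ^ 2)) := mul_pos (mul_pos hlam pj) hDpos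
        linarith
  -- (8) `J` is continuous on the window and at each zero has a negative derivative
  have hJdiff : ∀ T : ℝ, Tm < T → T < tj → DifferentiableAt ℝ J T := by
    intro T h1 h2
    obtain ⟨-, hφd⟩ := hder T h1 h2
    have hJd := hasDerivAt_indexForm w₀ wi wk a bi bk bj t₀ ti tk tj T d₀ di dk dj rfl rfl hφd (hdiffω T h1 h2).hasDerivAt
    rw [hJfun]
    exact hJd.differentiableAt
  have hJcont : ContinuousOn J (Ioo Tm tj) := fun T hT => ((hJdiff T hT.1 hT.2).continuousAt).continuousWithinAt
  have hJneg : ∀ z ∈ Ioo Tm tj, J z = 0 → HasDerivAt J (deriv J z) z ∧ deriv J z < 0 := by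
    intro z hz hJz
    obtain ⟨h1, h2⟩ := hz
    refine ⟨(hJdiff z h1 h2).hasDerivAt, ?_⟩
    obtain ⟨hFx, hφd⟩ := hder z h1 h2
    have hω0 : HasDerivAt ω 0 z := by
      have := (hdiffω z h1 h2).hasDerivAt
      rwa [(hJω z h1 h2).2 hJz] at this
    have hJd := hasDerivAt_indexForm w₀ wi wk a bi bk bj t₀ ti tk tj z d₀ di dk dj rfl rfl hφd hω0
    rw [hJfun, hJd.deriv]
    obtain ⟨-, r2⟩ := hraw z h1 h2 _ _ hφd hω0
    have hX : φ z ≠ 0 := ne_of_gt (hφ z h1 h2).1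
    have hO : ω z ≠ 0 := ne_of_gt (hωpos z h1 h2)
    obtain ⟨p0, pi, pk, pj⟩ := hWpos z h1 h2
    have hzj : z - tj ≠ 0 := by linarith
    have hS₂ : 0 < (-a) ^ 2 * (w₀ * φ z ^ d₀) * (z - t₀) ^ 2 + bi ^ 2 * (wi * φ z ^ di) * (z - ti) ^ 2 + bk ^ 2 * (wk * φ z ^ dk) * (z - tk) ^ 2 + bj ^ 2 * (ω z * φ z ^ dj) * (z - tj) ^ 2 := by
      have t0 : 0 ≤ (-a) ^ 2 * (w₀ * φ z ^ d₀) * (z - t₀) ^ 2 := by positivity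
      have t1 : 0 ≤ bi ^ 2 * (wi * φ z ^ di) * (z - ti) ^ 2 := by positivity
      have t2 : 0 ≤ bk ^ 2 * (wk * φ z ^ dk) * (z - tk) ^ 2 := by positivity
      have t3 : 0 < bj ^ 2 * (ω z * φ z ^ dj) * (z - tj) ^ 2 :=
        mul_pos (mul_pos (pow_pos hbj 2) pj) (by positivity)
      linarith
    have hJz' : (2 * ((-a) * (w₀ * φ z ^ d₀) * (z - t₀) + bi * (wi * φ z ^ di) * (z - ti) + bk * (wk * φ z ^ dk) * (z - tk) + bj * (ω z * φ z ^ dj) * (z - tj)) ^ 2 - ((w₀ * φ z ^ d₀) + (wi * φ z ^ di) + (wk * φ z ^ dk) + (ω z * φ z ^ dj)) * ((-a) ^ 2 * (w₀ * φ z ^ d₀) * (z - t₀) ^ 2 + bi ^ 2 * (wi * φ z ^ di) * (z - ti) ^ 2 + bk ^ 2 * (wk * φ z ^ dk) * (z - tk) ^ 2 + bj ^ 2 * (ω z * φ z ^ dj) * (z - tj) ^ 2)) = 0 := by rw [← hJdef]; exact hJz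
    have hfold : ((w₀ * φ z ^ d₀) + (wi * φ z ^ di) + (wk * φ z ^ dk) + (ω z * φ z ^ dj)) * ((-a) ^ 2 * (w₀ * φ z ^ d₀) * (z - t₀) ^ 2 + bi ^ 2 * (wi * φ z ^ di) * (z - ti) ^ 2 + bk ^ 2 * (wk * φ z ^ dk) * (z - tk) ^ 2 + bj ^ 2 * (ω z * φ z ^ dj) * (z - tj) ^ 2) = 2 * ((-a) * (w₀ * φ z ^ d₀) * (z - t₀) + bi * (wi * φ z ^ di) * (z - ti) + bk * (wk * φ z ^ dk) * (z - tk) + bj * (ω z * φ z ^ dj) * (z - tj)) ^ 2 := by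
      linear_combination (-1 : ℝ) * hJz'
    have cubic := indexFormDeriv_eq_cubic (T := z) hX hO (ne_of_gt hlam) hd₀ hdi hdk hdj (ne_of_gt hS₂) (hE2 z h1 h2) r2 hfold
    -- signs: `S₁ < 0` (lone letter fastest), `𝒞_W > 0` (hypothesis)
    have hSbg := mixedMoment_neg_of_fastest (W₀ := w₀ * φ z ^ d₀) (Wi := wi * φ z ^ di) (Wk := wk * φ z ^ dk) (Wj := ω z * φ z ^ dj)
      p0 pi pk ha hbj hti htk hi0 hk0 (by linarith) hij hkj (hE1 z h1 h2)
    obtain ⟨-, -, -, -, -, hlast⟩ := coupled_sums (w₀ * φ z ^ d₀) (wi * φ z ^ di) (wk * φ z ^ dk) (ω z * φ z ^ dj) a bi bk bj t₀ ti tk tj z c lam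
    have hS₁ : (-a) * (w₀ * φ z ^ d₀) * (z - t₀) + bi * (wi * φ z ^ di) * (z - ti) + bk * (wk * φ z ^ dk) * (z - tk) + bj * (ω z * φ z ^ dj) * (z - tj) < 0 := by
      rw [hE2 z h1 h2, sub_zero] at hlast
      have hz0 : 0 < z := by linarith
      by_contra hcon
      push Not at hcon
      have := mul_nonneg (by linarith : (0:ℝ) ≤ 2 * z) hcon
      linarith
    have hCW := hC z (φ z) (ω z) (by linarith) h2 (hφ z h1 h2).1 (hωpos z h1 h2) (hE1 z h1 h2) (hE2 z h1 h2) hfold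
    have h2S1 : 2 * ((-a) * (w₀ * φ z ^ d₀) * (z - t₀) + bi * (wi * φ z ^ di) * (z - ti) + bk * (wk * φ z ^ dk) * (z - tk) + bj * (ω z * φ z ^ dj) * (z - tj)) * (3 * ((-a) * (w₀ * φ z ^ d₀) + bi * (wi * φ z ^ di) + bk * (wk * φ z ^ dk) + bj * (ω z * φ z ^ dj)) * ((-a) ^ 2 * (w₀ * φ z ^ d₀) * (z - t₀) ^ 2 + bi ^ 2 * (wi * φ z ^ di) * (z - ti) ^ 2 + bk ^ 2 * (wk * φ z ^ dk) * (z - tk) ^ 2 + bj ^ 2 * (ω z * φ z ^ dj) * (z - tj) ^ 2) ^ 2 - 6 * ((-a) ^ 2 * (w₀ * φ z ^ d₀) * (z - t₀) + bi ^ 2 * (wi * φ z ^ di) * (z - ti) + bk ^ 2 * (wk * φ z ^ dk) * (z - tk) + bj ^ 2 * (ω z * φ z ^ dj) * (z - tj)) * ((-a) * (w₀ * φ z ^ d₀) * (z - t₀) + bi * (wi * φ z ^ di) * (z - ti) + bk * (wk * φ z ^ dk) * (z - tk) + bj * (ω z * φ z ^ dj) * (z - tj)) * ((-a) ^ 2 *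 (w₀ * φ z ^ d₀) * (z - t₀) ^ 2 + bi ^ 2 * (wi * φ z ^ di) * (z - ti) ^ 2 + bk ^ 2 * (wk * φ z ^ dk) * (z - tk) ^ 2 + bj ^ 2 * (ω z * φ z ^ dj) * (z - tj) ^ 2) + 2 * ((-a) ^ 3 * (w₀ * φ z ^ d₀) * (z - t₀) ^ 2 + bi ^ 3 * (wi * φ z ^ di) * (z - ti) ^ 2 + bk ^ 3 * (wk * φ z ^ dk) * (z - tk) ^ 2 + bj ^ 3 * (ω z * φ z ^ dj) * (z - tj) ^ 2) * ((-a) * (w₀ * φ z ^ d₀) * (z - t₀) + bi * (wi * φ z ^ di) * (z - ti) + bk * (wk * φ z ^ dk) * (z - tk) + bj * (ω z * φ z ^ dj) * (z - tj)) ^ 2) < 0 :=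
      mul_neg_of_neg_of_pos (by linarith) hCW
    have hlt := cubic.trans_lt h2S1
    by_contra hcon
    push Not at hcon
    exact absurd hlt (not_lt.mpr (mul_nonneg (pow_pos hS₂ 2).le hcon))
  -- (9) the one-zero lemma
  have hk₁J : J k₁ = 0 := (hJω k₁ (by linarith [hk₁.1]) (by linarith [hk₁.2])).1 hk₁0
  have hk₂J : J k₂ = 0 := (hJω k₂ (by linarith [hk₂.1]) (by linarith [hk₂.2])).1 hk₂0
  have heq := eq_of_zeros_of_hasDerivAt_neg hJcont hJneg (z₁ := k₁) (z₂ := k₂)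
    ⟨by linarith [hk₁.1], by linarith [hk₁.2]⟩ ⟨by linarith [hk₂.1], by linarith [hk₂.2]⟩ hk₁J hk₂J
  linarith [hk₁.2, hk₂.1]


end Summit.ValiantsHypothesis.ValiantsHypothesis.Theorems.LacunarySymmetroidMatrixDescartes.Pivot.CriticalWindows.Four
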